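import Literature.NumberTheory.Sieve.RamanujanSum
import HarnessLib

/-!
# Hölder's closed form of the Ramanujan sum: `c_q(h) = μ(q/(q,h)) · φ(q)/φ(q/(q,h))`
(Hardy–Wright, Thm 272)

Source (read at the page; held `lit book:hardy2008-introduction-theory-numbers`, PDF p. 189):
G. H. Hardy, E. M. Wright, *An Introduction to the Theory of Numbers* (6th ed., OUP 2008), §16.6
"Evaluation of Ramanujan's sum": **Theorem 271** `c_n(m) = ∑_{d ∣ m, d ∣ n} μ(n/d) d` (Kluyver;
in the tree as `Literature.NumberTheory.Sieve.ramanujanSum_eq_ramanujanDivisorSum`) and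
**Theorem 272** "If `(n, m) = a` and `n = aN`, then `c_n(m) = μ(N) φ(n)/φ(N)`", attributed in the
Notes to §16.6 (p. 192 of the PDF) to Hölder, *Prace Mat. Fiz.* 43 (1936) 13–23.

## Content (all proved)

* `sum_divisors_ramanujanDivisorSum` — `∑_{d ∣ q} c_d(h) = q·[q ∣ h]` for the integer-valued Kluyver
  form (Möbius inversion undone: `ζ * (μ * D) = D`).
* `ramanujanDivisorSum_prime_pow` — `c_{p^i}(h) = p^i [p^i ∣ h] - p^{i-1} [p^{i-1} ∣ h]` (`i ≥ 1`),
  integer form (the complex-valued version is `…IncompleteKloostermanSmooth.ramanujanSum_prime_pow`).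
* **`ramanujanDivisorSum_mul_totient_div`** — Hölder / Hardy–Wright Thm 272 in division-free
  integer form: `c_q(h) · φ(q/(q,h)) = μ(q/(q,h)) · φ(q)` for all `q, h : ℕ` (proof: both sides are
  multiplicative in `q`; compare on prime powers, three cases `p^i ∣ h`, `p^{i-1} ∥`, neither).
* **`ramanujanSum_eq_moebius_mul_totient_div`** — the printed form for the exponential sum
  `c_q(h) = ∑_{a mod q, (a,q)=1} e(ah/q)`: `c_q(h) = μ(N) φ(q)/φ(N)`, `N = q/(q,|h|)`, `q ≠ 0`.

Design: the quotient `N = q/(q,h)` is written `q / Nat.gcd q h` throughout (for `h = 0`,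
`(q,0) = q` and `N = 1`, giving `c_q(0) = φ(q)`).
-/

open Finset ArithmeticFunction
open scoped ArithmeticFunction.Moebius ArithmeticFunction.zeta

namespace Literature.NumberTheory.Sieve

/-- **`∑_{d ∣ q} c_d(h) = q·[q ∣ h]`** for the Kluyver form `c = μ * (n ↦ n[n ∣ h])` (`q ≠ 0` not
needed: both sides vanish at `q = 0`): `ζ * (μ * D) = (ζ * μ) * D = D`. This is Hardy–Wright's
`g(n) = ∑_{d ∣ n} f(d)` with `g(n) = n` or `0` according as `n ∣ m` or not (proof of Thm 271).
[cite: HardyWright2008, §16.6 Thm 271 (proof)] -/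
theorem sum_divisors_ramanujanDivisorSum (h q : ℕ) :
    ∑ d ∈ q.divisors, ramanujanDivisorSum h d = if q ∣ h then (q : ℤ) else 0 := by
  have key : (ζ : ArithmeticFunction ℤ) * ramanujanDivisorSum h = dvdIndicatorMulId h := by
    rw [ramanujanDivisorSum, ← mul_assoc, coe_zeta_mul_moebius, one_mul]
  rw [← dvdIndicatorMulId_apply, ← key, coe_zeta_mul_apply]

/-- **Prime-power values** (integer form): for `i ≥ 1`,
`c_{p^i}(h) = p^i [p^i ∣ h] - p^{i-1} [p^{i-1} ∣ h]`. [cite: HardyWright2008, §16.6 Thm 271] -/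
theorem ramanujanDivisorSum_prime_pow (h : ℕ) {p : ℕ} (hp : p.Prime) {i : ℕ} (hi : 1 ≤ i) :
    ramanujanDivisorSum h (p ^ i) =
      (if p ^ i ∣ h then ((p ^ i : ℕ) : ℤ) else 0) -
        (if p ^ (i - 1) ∣ h then ((p ^ (i - 1) : ℕ) : ℤ) else 0) := by
  have hsum : ∀ b : ℕ, ∑ j ∈ Finset.range (b + 1), ramanujanDivisorSum h (p ^ j) =
      if p ^ b ∣ h then ((p ^ b : ℕ) : ℤ) else 0 := by
    intro b
    have h1 := sum_divisors_ramanujanDivisorSum h (p ^ b)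
    rw [Nat.divisors_prime_pow hp b, Finset.sum_map] at h1
    exact h1
  have h1 := hsum i
  have h2 := hsum (i - 1)
  rw [show i - 1 + 1 = i from Nat.sub_add_cancel hi] at h2
  rw [Finset.sum_range_succ, h2] at h1
  rw [← h1]
  ring

namespace RamanujanSumHoelder

/-- The quotient `q ↦ q/(q,h)` is multiplicative on coprime arguments. [folklore] -/
private theorem quot_mul {m n : ℕ} (hmn : m.Coprime n) (h : ℕ) :
    m * n / Nat.gcd (m * n) h = (m / Nat.gcd m h) * (n / Nat.gcd n h) := by
  rw [Nat.gcd_comm, Nat.Coprime.gcd_mul h hmn, Nat.gcd_comm h m, Nat.gcd_comm h n,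
    Nat.div_mul_div_comm (Nat.gcd_dvd_left m h) (Nat.gcd_dvd_left n h)]

/-- The quotients of coprime numbers are coprime. [folklore] -/
private theorem coprime_quot {m n : ℕ} (hmn : m.Coprime n) (h : ℕ) :
    (m / Nat.gcd m h).Coprime (n / Nat.gcd n h) :=
  Nat.Coprime.coprime_dvd_left (Nat.div_dvd_of_dvd (Nat.gcd_dvd_left m h))
    (Nat.Coprime.coprime_dvd_right (Nat.div_dvd_of_dvd (Nat.gcd_dvd_left n h)) hmn)

/-- The gcd of a prime power `p^i` with `h` is `p^j` for some `j ≤ i`. [folklore] -/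
private theorem gcd_prime_pow_eq {p : ℕ} (hp : p.Prime) (i h : ℕ) :
    ∃ j ≤ i, Nat.gcd (p ^ i) h = p ^ j :=
  (Nat.dvd_prime_pow hp).mp (Nat.gcd_dvd_left (p ^ i) h)

/-- **Prime-power case of Hölder's identity**: for `i ≥ 1`,
`c_{p^i}(h) · φ(p^i/(p^i,h)) = μ(p^i/(p^i,h)) · φ(p^i)`. [cite: HardyWright2008, §16.6 Thm 272] -/
private theorem prime_pow_case (h : ℕ) {p : ℕ} (hp : p.Prime) {i : ℕ} (hi : 1 ≤ i) :
    ramanujanDivisorSum h (p ^ i) * (Nat.totient (p ^ i / Nat.gcd (p ^ i) h) : ℤ) =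
      (μ (p ^ i / Nat.gcd (p ^ i) h) : ℤ) * (Nat.totient (p ^ i) : ℤ) := by
  obtain ⟨j, hji, hj⟩ := gcd_prime_pow_eq hp i h
  have hp0 : 0 < p := hp.pos
  have hp1 : 1 < p := hp.one_lt
  have hpow : p ^ i / Nat.gcd (p ^ i) h = p ^ (i - j) := by
    rw [hj, Nat.pow_div hji hp0]
  rw [ramanujanDivisorSum_prime_pow h hp hi, hpow]
  have hgdvd : p ^ j ∣ h := hj ▸ Nat.gcd_dvd_right (p ^ i) h
  by_cases hA : p ^ i ∣ h
  · -- case A: `p^i ∣ h`, `j = i`, quotient `1`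
    have hji' : j = i := by
      have : p ^ i ∣ p ^ j := hj ▸ Nat.dvd_gcd dvd_rfl hA
      exact le_antisymm hji ((Nat.pow_dvd_pow_iff_le_right hp1).mp this)
    have hA' : p ^ (i - 1) ∣ h := (pow_dvd_pow p (Nat.sub_le i 1)).trans hA
    rw [if_pos hA, if_pos hA', hji', Nat.sub_self, pow_zero, Nat.totient_one,
      ArithmeticFunction.moebius_apply_one, Nat.totient_prime_pow hp hi]
    push_cast
    rw [Nat.cast_sub hp.one_le, Nat.cast_one]
    have : (p : ℤ) ^ i = (p : ℤ) ^ (i - 1) * p := by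
      rw [← pow_succ, Nat.sub_add_cancel hi]
    rw [this]
    ring
  · by_cases hB : p ^ (i - 1) ∣ h
    · -- case B: `p^{i-1} ∣ h`, `p^i ∤ h`: `j = i - 1`, quotient `p`
      have hji' : j = i - 1 := by
        have h1 : p ^ (i - 1) ∣ p ^ j := hj ▸ Nat.dvd_gcd (pow_dvd_pow p (Nat.sub_le i 1)) hB
        have h2 : i - 1 ≤ j := (Nat.pow_dvd_pow_iff_le_right hp1).mp h1
        have h3 : j ≠ i := fun hji2 => hA (hji2 ▸ hgdvd)
        omega
      rw [if_neg hA, if_pos hB, hji', show i - (i - 1) = 1 by omega, pow_one,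
        ArithmeticFunction.moebius_apply_prime hp, Nat.totient_prime hp,
        Nat.totient_prime_pow hp hi]
      push_cast
      rw [Nat.cast_sub hp.one_le, Nat.cast_one]
      ring
    · -- case C: `p^{i-1} ∤ h`: `j ≤ i - 2`, quotient `p^{i-j}` not squarefree, `c = 0`
      have hj2 : j + 2 ≤ i := by
        by_contra hcon
        have : i - 1 ≤ j := by omega
        exact hB ((pow_dvd_pow p this).trans hgdvd)
      have hnsq : ¬ Squarefree (p ^ (i - j)) := by
        intro hsq
        have hdvd : p * p ∣ p ^ (i - j) := by
          rw [← pow_two]; exact pow_dvd_pow p (by omega)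
        exact hp.not_isUnit (hsq p hdvd)
      rw [if_neg hA, if_neg hB, ArithmeticFunction.moebius_eq_zero_of_not_squarefree hnsq]
      simp

end RamanujanSumHoelder

open RamanujanSumHoelder in
/-- **Hölder's identity (Hardy–Wright, Thm 272), division-free integer form**: for all `q, h`,
`c_q(h) · φ(q/(q,h)) = μ(q/(q,h)) · φ(q)`, where `c_q(h) = ∑_{d ∣ (q,h)} d μ(q/d)` is the Kluyver
form `ramanujanDivisorSum h q`. ("If `(n, m) = a` and `n = aN`, then `c_n(m) = μ(N)φ(n)/φ(N)`";
H&W attribute it to Hölder, Prace Mat. Fiz. 43 (1936).) Proof: both sides are multiplicative in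
`q`, and agree on prime powers (`prime_pow_case`). [cite: HardyWright2008, §16.6 Thm 272] -/
theorem ramanujanDivisorSum_mul_totient_div (h q : ℕ) :
    ramanujanDivisorSum h q * (Nat.totient (q / Nat.gcd q h) : ℤ) =
      (μ (q / Nat.gcd q h) : ℤ) * (Nat.totient q : ℤ) := by
  -- the three auxiliary arithmetic functions `q ↦ φ(q/(q,h))`, `q ↦ μ(q/(q,h))`, `q ↦ φ(q)`
  let T : ArithmeticFunction ℤ := ⟨fun q => (Nat.totient (q / Nat.gcd q h) : ℤ), by simp⟩
  let M : ArithmeticFunction ℤ := ⟨fun q => (μ (q / Nat.gcd q h) : ℤ), by simp⟩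
  let Φ : ArithmeticFunction ℤ := ⟨fun q => (Nat.totient q : ℤ), by simp⟩
  have hT : ∀ q, T q = (Nat.totient (q / Nat.gcd q h) : ℤ) := fun q => rfl
  have hM : ∀ q, M q = (μ (q / Nat.gcd q h) : ℤ) := fun q => rfl
  have hΦ : ∀ q, Φ q = (Nat.totient q : ℤ) := fun q => rfl
  have hTm : T.IsMultiplicative := by
    refine ⟨by rw [hT]; simp, fun {m n} hmn => ?_⟩
    rw [hT, hT, hT, quot_mul hmn h, Nat.totient_mul (coprime_quot hmn h), Nat.cast_mul]
  have hMm : M.IsMultiplicative := by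
    refine ⟨by rw [hM]; simp, fun {m n} hmn => ?_⟩
    rw [hM, hM, hM, quot_mul hmn h, isMultiplicative_moebius.map_mul_of_coprime (coprime_quot hmn h)]
  have hΦm : Φ.IsMultiplicative := by
    refine ⟨by rw [hΦ]; simp, fun {m n} hmn => ?_⟩
    rw [hΦ, hΦ, hΦ, Nat.totient_mul hmn, Nat.cast_mul]
  have hL : ((ramanujanDivisorSum h).pmul T).IsMultiplicative :=
    (isMultiplicative_ramanujanDivisorSum h).pmul hTm
  have hR : (M.pmul Φ).IsMultiplicative := hMm.pmul hΦm
  have heq : (ramanujanDivisorSum h).pmul T = M.pmul Φ := by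
    refine (IsMultiplicative.eq_iff_eq_on_prime_powers _ hL _ hR).mpr fun p i hp => ?_
    rcases Nat.eq_zero_or_pos i with rfl | hi
    · rw [pow_zero, hL.map_one, hR.map_one]
    · rw [pmul_apply, pmul_apply, hT, hM, hΦ]
      exact prime_pow_case h hp hi
  have := congr_arg (fun f : ArithmeticFunction ℤ => f q) heq
  simp only [pmul_apply] at this
  rw [hT, hM, hΦ] at this
  exact this

/-- **Hardy–Wright, Thm 272 (Hölder 1936), as printed**: for `q ≠ 0` and `h ∈ ℤ`, with
`N = q/(q,|h|)`, the Ramanujan sum `c_q(h) = ∑_{a mod q, (a,q)=1} e(ah/q)` equals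
`μ(N) φ(q)/φ(N)`. [cite: HardyWright2008, §16.6 Thm 272] -/
theorem ramanujanSum_eq_moebius_mul_totient_div {q : ℕ} (hq : q ≠ 0) (h : ℤ) :
    ramanujanSum q h =
      (μ (q / Nat.gcd q h.natAbs) : ℂ) * (Nat.totient q : ℂ) /
        (Nat.totient (q / Nat.gcd q h.natAbs) : ℂ) := by
  have hN : 0 < q / Nat.gcd q h.natAbs :=
    Nat.div_pos (Nat.le_of_dvd (Nat.pos_of_ne_zero hq) (Nat.gcd_dvd_left _ _))
      (Nat.gcd_pos_of_pos_left _ (Nat.pos_of_ne_zero hq))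
  have hφ : (Nat.totient (q / Nat.gcd q h.natAbs) : ℂ) ≠ 0 :=
    Nat.cast_ne_zero.mpr (Nat.totient_pos.mpr hN).ne'
  rw [eq_div_iff hφ, ramanujanSum_eq_ramanujanDivisorSum]
  have := ramanujanDivisorSum_mul_totient_div h.natAbs q
  exact_mod_cast this

/-- Corollary (`(q, h) = 1`): `c_q(h) = μ(q)`; and (`q ∣ h`): `c_q(h) = φ(q)` — the two extreme
cases of Thm 272, integer form. [cite: HardyWright2008, §16.6 Thm 272] -/
theorem ramanujanDivisorSum_of_dvd {q h : ℕ} (hqh : q ∣ h) :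
    ramanujanDivisorSum h q = Nat.totient q := by
  have := ramanujanDivisorSum_mul_totient_div h q
  rcases Nat.eq_zero_or_pos q with rfl | hq
  · simp
  · rw [Nat.gcd_eq_left hqh, Nat.div_self hq, Nat.totient_one, Nat.cast_one, mul_one,
      ArithmeticFunction.moebius_apply_one, one_mul] at this
    exact this

end Literature.NumberTheory.Sieve
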